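import Summits.HodgeConjecture.HodgeConjecture.Theorems.F0P6aEExportsFrames
import HarnessLib

/-!
# `F0P6aEExports` — ★ RE-HOME of `Lines/F0_P6a_EExports.lean`, PART 3 of 3 (size-lint split; cut at a declaration boundary).

## Import provenance
- `Theorems.F0P6aEExportsFrames` = ★ previous part of the same `Lines` workfile `F0_P6a_EExports` (size-lint split ×3); `HarnessLib`.

See PART 1 `Theorems/F0P6aEExportsReadings.lean` for the full re-home header and the original module docstring (verbatim there). Namespaces and sections KEPT
(re-opened below exactly as they stand at the cut, with their `open`∕`variable` lines replayed); code bytes = the workfile՚s, docstrings included; options preamble repeated from PART 1.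
HC_CM is proved only modulo the 7 printed citations (2 remaining: hLiu418 = stmt-HodgeConjecture-24832, h413 = stmt-HodgeConjecture-24833) until rung 0 closes; a re-home is count-neutral. -/

set_option autoImplicit false

noncomputable section

namespace Summit.HodgeConjecture.HodgeConjecture.Cruxes.HLiu418.F0P6aEExports
set_option linter.dupNamespace false  -- `Summit.HodgeConjecture.HodgeConjecture.…` BY DESIGN (D-0017)
open CategoryTheory CategoryTheory.Limits NumberField IsDedekindDomain MulAction AlgebraicGeometry
open scoped Matrix Polynomial Pointwise
open Literature.NumberTheory.GaloisRepresentations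
open Literature.NumberTheory.Automorphic Literature.NumberTheory.Automorphic.UnitaryGroup
open Literature.AlgebraicGeometry.ShimuraVarieties Literature.AlgebraicGeometry.ShimuraVarieties.UnitaryCanonicalModel
open Literature.NumberTheory.Automorphic.Liu2021.AppendixC
open Literature.AlgebraicGeometry.Motives (AlgPoints ComplexPoints SchemeOver thickeningLift specOver)
open Literature.AlgebraicGeometry.Motives.AbelianVariety (bcSpec)
open Literature.AlgebraicGeometry.AbelianSchemes (PolarizedAbelianSchemeWithLevel AbelianSchemeOver)
open Literature.AlgebraicGeometry.ModuliOfAbelianVarieties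
open Summit.HodgeConjecture.HodgeConjecture.Cruxes.HLiu418.F0P6aPELWitnessE
open Summit.HodgeConjecture.HodgeConjecture.Cruxes.HLiu418.F0P6aStubE6 (RingActionReading RosatiOver KottwitzOver ReadsC
  readsC_of_galois_of_reading exists_reads_of_readsC exists_ringActionReading_of_reads rosatiOver_of_ringActionReading kottwitzOver_of_reading)
open Summit.HodgeConjecture.HodgeConjecture.Cruxes.HLiu418.F0P6aSigmaGAL (sigmaGAL_of_stub)
open Summit.HodgeConjecture.HodgeConjecture.Cruxes.HLiu418.F0P6aStubKOTT (KottAdaptedAt UnmixedAt)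
open Summit.HodgeConjecture.HodgeConjecture.Cruxes.HLiu418.F0P6aPELInputs (ESepAt)
open Summit.HodgeConjecture.HodgeConjecture.Cruxes.HLiu418.F0P6aEReadings (EHeckeAt ETwistKerAt HeckeRoofsE CoverKerE CoverE)
open Summit.HodgeConjecture.HodgeConjecture.Theorems.F0P6aReadsCReadingOfJunction (readsCReading_of_junction)
open Summit.HodgeConjecture.HodgeConjecture.Cruxes.HLiu418.F0P6aChartFramePin (IsChartOfFrame)
open Literature.AlgebraicGeometry.Motives (CMType)
open Literature.AlgebraicGeometry.ShimuraVarieties.UnitaryCanonicalModel.Aux (ratBasis torusFinAdelic)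
open Literature.AlgebraicGeometry.ShimuraVarieties.UnitaryCurve Literature.AlgebraicGeometry.ShimuraVarieties.UnitaryCurve.AuxV
open Literature.NumberTheory.ComplexMultiplication.CMTypeOps (flip bar)


/-- **`stub_EFRAMES` — PAID IN ED. 1** (cand v2): the letter `RecordEFrames` — common-level charts for a finite family of frames — is `eFrames_of_line` (§6a, LA4-p02 (g2) by copy:
E1 «COMMON LATTICE» ★ p849552 + «COMMON SMALL LEVEL» ★ p849614 + `stub_E123`՚s body per frame); registered name and letter kept. [cite: Deligne1971TravauxShimura, Prop. 1.15 p. 132] [cite: RapoportSmithlingZhang2020Diagonal, §3.2 pp. 11–14] -/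
theorem stub_EFRAMES : RecordEFrames :=
  eFrames_of_line

/-- **HEAD `eLaws_of_frames` — THE MULTI-FRAME E-EXPORT GEN CONSUMES**: for every letter context (with Hecke translates over `F`), small level `K` and FINITE family of CM
types `Φf i ∋ ι₁`, ONE small level `Kc'' ≤ K` normal in `K` such that EVERY frame `i` has, over every slice field `Fᵢ ⊇ Fᵢ₀(i)` (so over a Galois compositum of the
`Fᵢ₀(i)` inside `ℂ`, ★ p849484 — GEN՚s call), a witness `E : PELWitnessE … Kc'' Fi τE (Φf i)` WITH the E-block of `RecordGENChoicesCofinal` (tokens d41c4085 :115–:119,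
`Kc ↦ Kc''`, `Ef i ↦ E`) under GEN՚s own guards (hyperspecial, unit form, `(p, f)`, `p ∤ E.N`; adapted∕unmixed for (T-E)).  Sorry-free modulo {`stub_EFRAMES`, `stub_EHECKE`,
`stub_ESHEET`} (+ L7՚s printed `stub_RELEXP`): `stub_SIG` → `stub_EFRAMES` → per frame `exists_slice_reading` → `witnessOf` → the three laws.
[cite: RapoportSmithlingZhang2020Diagonal, §4.1 Thm. 4.1 p. 17] [cite: Deligne1971TravauxShimura, 4.16 p. 150] [cite: Kottwitz1992, §5 pp. 389–391]
[cite: Liu2021, Lemma C.18 p. 115, Prop. D.8 p. 135] [cite: Shimura1998, §13.1 Thm. 1; §18.6 Thm. 18.6] -/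
theorem eLaws_of_frames (F : Type) [Field F] [NumberField F] [IsCMField F] [IsGalois ℚ F] (ι₁ : F →+* ℂ)
    (Jstar : Matrix (Fin 2) (Fin 2) F) (hJ : (Jstar.map (IsCMField.complexConj F))ᵀ = Jstar) (hJu : IsUnit Jstar)
    (K₀ : C5.OpenCompactSubgroup (GSAdele F Jstar)) (S : RecordSystemGS F Jstar ι₁ K₀) (hU7ₛ : S.HeckeTranslateDefinedOver) (K : C5.SmallLevel K₀)
    (ιdx : Type) [Finite ιdx] (Φf : ιdx → Set (F →+* ℂ)) (hΦf : ∀ i, IsCMTypeThrough ι₁ (Φf i)) :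
    ∃ (Kc'' : C5.SmallLevel K₀), Kc'' ≤ K ∧ (∀ u ∈ K.1.1, C5.HeckeLE u Kc'' Kc'') ∧
      ∀ i : ιdx, ∃ (Fi₀ : Type) (_ : Field Fi₀) (_ : NumberField Fi₀) (_ : Algebra F Fi₀) (_ : IsGalois F Fi₀) (τ₀ : Fi₀ →+* ℂ),
        τ₀.comp (algebraMap F Fi₀) = ι₁ ∧
        ∀ (Fi : Type) [Field Fi] [NumberField Fi] [Algebra F Fi] [IsGalois F Fi] (τE : Fi →+* ℂ) (j : Fi₀ →ₐ[F] Fi),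
          τE.comp (j : Fi₀ →+* Fi) = τ₀ →
          ∃ E : PELWitnessE F ι₁ Jstar K₀ S Kc'' Fi τE (Φf i),
            ∀ (w : HeightOneSpectrum (𝓞 F)) (hw : (IsCMField.complexConj F) • w ≠ w),
              ESepAt S Kc'' w E ∧
              (UnitaryGroup.IsHyperspecialAt ↥(maximalRealSubfield F) F (IsCMField.complexConj F) 2 Jstar Kc''.1.1
                  (w.under (𝓞 ↥(maximalRealSubfield F))) →
                (UnitaryGroup.isUnit_placeForm Jstar hJu w).unit ∈ glInt 2 (w.adicCompletion F) →
                ∀ (pChar fDeg : ℕ), Nat.Prime pChar → (pChar : 𝓞 F) ∈ w.asIdeal →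
                  Nat.card (𝓞 F ⧸ ((IsCMField.complexConj F) • w).asIdeal) = pChar ^ fDeg → ¬ pChar ∣ E.N →
                  EHeckeAt S hU7ₛ hJ hJu Kc'' w hw E pChar fDeg ∧
                    (KottAdaptedAt ι₁ w (Φf i) → UnmixedAt ι₁ w (Φf i) →
                      ∀ e : Fi →ₐ[F] AlgebraicClosure (w.adicCompletion F), ETwistKerAt S Kc'' w e E pChar fDeg)) := by
  -- the common level and the per-frame charts (`stub_EFRAMES`, fed by `stub_SIG`)
  obtain ⟨Kc'', hle, hnorm, hcharts⟩ :=
    stub_EFRAMES F ι₁ Jstar hJ hJu K₀ S K ιdx Φf hΦf (stub_SIG F ι₁ Jstar hJ hJu K₀ S K)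
  refine ⟨Kc'', hle, hnorm, fun i => ?_⟩
  obtain ⟨Fi₀, _, _, _, _, τ₀, hτ₀, hchart⟩ := hcharts i
  refine ⟨Fi₀, ‹_›, ‹_›, ‹_›, ‹_›, τ₀, hτ₀, fun Fi _ _ _ _ τE j hj => ?_⟩
  obtain ⟨C, ξ, k, Fr, hpin⟩ := hchart Fi τE j hj
  have hτE : τE.comp (algebraMap F Fi) = ι₁ := by
    rw [← j.comp_algebraMap, ← RingHom.comp_assoc, hj, hτ₀]
  obtain ⟨ε, hε, ρ, hρ, hsep⟩ := exists_slice_reading F ι₁ Jstar hJ hJu K₀ S Kc'' Fi τE hτE (Φf i) (hΦf i) C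
  refine ⟨witnessOf C ε ρ (rosatiOver_of_ringActionReading hτE C ε ρ hρ) (kottwitzOver_of_reading hτE C ε ρ hρ) hsep, fun w hw => ⟨?_, ?_⟩⟩
  · exact eSepAt_of_witness _ w
  · intro hhyp hunit pChar fDeg hp hpw hcard hN
    exact ⟨eHeckeAt_witnessOf F ι₁ Jstar hJ hJu K₀ S hU7ₛ Kc'' Fi τE hτE (Φf i) (hΦf i) C ξ k Fr hpin ε hε ρ hρ _ _ hsep w hw hhyp hunit pChar fDeg
        hp hpw hcard hN,
      fun had hun e => eTwistKerAt_witnessOf F ι₁ Jstar hJ hJu K₀ S hU7ₛ Kc'' Fi τE hτE (Φf i) (hΦf i) C ξ k Fr hpin ε hε ρ hρ _ _ hsep w hw hhyp hunit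
        pChar fDeg hp hpw hcard hN had hun e⟩

end Summit.HodgeConjecture.HodgeConjecture.Cruxes.HLiu418.F0P6aEExports

end
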